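import Summits.KontsevichZagierPeriods.Zeta5Search.DenomLaw.OrbitCreditHMulti

/-!
# ζ(5) search — DENOM-LAW track D3: the OrbitCredit lineage's remaining statement nodes, closed (corollaries only)

Seventh file of the OrbitCredit lineage (denom-theory-d3 g5; filed by the prover seat denom-engine-d2).  No new mathematics: the H* unit (VH) is the
tree theorem `vh_holds` (`DenomLaw/OrbitCreditHMulti.lean`, from `classOrbitBound_holds`, `orbitFloorHStar_holds`, `vh_shape`).  This file
(i) registers the statement of (VH) by name, `HStarVBound` (the type of `vh_holds` verbatim), with its proof-of-item `hStarVBound_holds := vh_holds`, and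
(ii) closes the two `@[conjecture]` nodes of the lineage that are still formally open although they follow at once from landed theorems:
`FloorLayerCreditedUnderH` (stated in `DenomLaw/OrbitCredit.lean`; = case (S) `floorLayerSingleH_holds` ∧ case (T) `floorLayerMultiH_holds` via
`floorLayerCreditedUnderH_of_cases`) and the deprecated ∀-form `OrbitFloorH` (weaker than `OrbitFloorHStar`, because the deprecated predicate
`HasLoopAndPair` — a large loop at `j` and a large pair through `j` for EVERY `k ≠ j` — implies `LoopAndPair` — for SOME `k ≠ j`).  After this file no
`@[conjecture]` node of `DenomLaw/OrbitCredit*.lean` is open; new work uses `OrbitFloorHStar` / `LoopAndPair` / `HStarVBound`.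
HONEST FRAMING: systematic search; p-adic valuation statements about the rational numbers V(b) of the cell's dual linear forms; the exactness rates of
SYMMETRY-D3 §8–§10 are MODEL data; nothing about ζ(5); no γ moves; no irrationality claim; records in print UNMOVED.
-/

open Summit.KontsevichZagierPeriods.Zeta5Search.WedgeDictionary (coeffV dOf)
open Summit.KontsevichZagierPeriods.Zeta5Search.CasoratianValuation (InPolytope pairFloors)

namespace Summit.KontsevichZagierPeriods.Zeta5Search.ClusterValuation.Orbit

open Summit.KontsevichZagierPeriods.Zeta5Search.ClusterValuation

/-! ### (VH) by name -/

/-- **(VH) as a registered statement** — the H* unit on the value `V(b)`, exactly the type of `vh_holds` (tagged `@[conjecture]` only so that the audit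
registers its proof `hStarVBound_holds`, as for `ClassOrbitBound`). -/
@[conjecture] def HStarVBound : Prop :=
  ∀ (b : ℕ → ℤ) (p : ℕ) (v : ℤ), InPolytope b → p.Prime → 5 ≤ p → (p : ℤ) ≤ b 0 → (b 0 + 2 : ℤ) < (p : ℤ) ^ 2 →
    (p : ℤ) ≤ dOf b → dOf b < 2 * (p : ℤ) → mOne b < 2 * (p : ℤ) → LoopAndPair b p →
      vbPlus b p = some v → coeffV b ≠ 0 → ((-pairFloors b p + 1 : ℤ) : ℚ) ≤ (padicValRat p (coeffV b) : ℚ)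

/-- **(VH) is a theorem** (PROVED: `vh_holds`). -/
theorem hStarVBound_holds : HStarVBound := vh_holds

/-! ### No `@[conjecture]` node of the lineage stays open -/

/-- **Layer 2 (`FloorLayerCreditedUnderH`, p358841) is a theorem**: the two floor cases. -/
theorem floorLayerCreditedUnderH_holds : FloorLayerCreditedUnderH :=
  floorLayerCreditedUnderH_of_cases floorLayerSingleH_holds floorLayerMultiH_holds

set_option linter.deprecated false in
/-- The deprecated predicate `HasLoopAndPair` (large pair through `j` for EVERY `k ≠ j`) implies `LoopAndPair` (for SOME `k ≠ j`). -/
theorem loopAndPair_of_hasLoopAndPair {b : ℕ → ℤ} {p : ℕ} (h : HasLoopAndPair b p) : LoopAndPair b p := by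
  obtain ⟨j, hj1, hj7, hloop, hall⟩ := h
  by_cases hj : j = 1
  · exact ⟨j, Finset.mem_Icc.2 ⟨hj1, hj7⟩, hloop, 2, Finset.mem_Icc.2 ⟨by norm_num, by norm_num⟩, by omega,
      hall 2 (by norm_num) (by norm_num) (by omega)⟩
  · exact ⟨j, Finset.mem_Icc.2 ⟨hj1, hj7⟩, hloop, 1, Finset.mem_Icc.2 ⟨le_rfl, by norm_num⟩, by omega,
      hall 1 le_rfl (by norm_num) (by omega)⟩

set_option linter.deprecated false in
/-- So the deprecated ∀-form `OrbitFloorH` (p358010; a weaker statement than `OrbitFloorHStar`) is a theorem too — closed only so that the audit shows no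
open conjecture node in the OrbitCredit lineage; new work uses `OrbitFloorHStar` / `LoopAndPair`. -/
theorem orbitFloorH_holds : OrbitFloorH := by
  intro b p v hb hprime hp5 hpb hwin hd1 hd2 hm1 hH hv
  exact orbitFloorHStar_holds b p v hb hprime hp5 hpb hwin hd1 hd2 hm1 (loopAndPair_of_hasLoopAndPair hH) hv

end Summit.KontsevichZagierPeriods.Zeta5Search.ClusterValuation.Orbit
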